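import Literature.Analysis.Convexity.AnisotropicIsoperimetricMollified
import Mathlib.Analysis.Calculus.BumpFunction.Convolution
import Mathlib.Analysis.Calculus.BumpFunction.InnerProduct
import HarnessLib

/-!
# The anisotropic isoperimetric (Wulff) inequality for the distributional `K`-perimeter

Topic `Literature/Analysis/Convexity`; last file of the series `AnisotropicIsoperimetric*.lean`.

**Theorem** (`anisotropic_isoperimetric_inequality`). Let `n ≥ 2`, `K ⊆ ℝⁿ` compact and convex
with `0 ∈ K`, and `G ⊆ ℝⁿ` measurable of finite volume. Then

  `n · vol(K)^{1/n} · vol(G)^{(n-1)/n} ≤ P_K(G) := sup {∫_G div η : η ∈ C¹_c(ℝⁿ; ℝⁿ), η(x) ∈ K}`.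

`P_K(G)` is the distributional anisotropic perimeter with constraint body `K` (for smooth `G` it
is `∫_{∂G} h_K(ν_G)`, `h_K` the support function; for `K` the unit ball it is De Giorgi's
perimeter of `Literature/MathematicalPhysics/StatisticalMechanics/FccTexturedSet.lean`). The
inequality is the Wulff inequality `P_K(G) ≥ n |K|^{1/n} |G|^{(n-1)/n}` (equality for `G = K`;
Taylor 1978, Fonseca–Müller 1991 for sets of finite perimeter; Gardner 2002 §5 for the deduction
from Brunn–Minkowski). It is written out with the `iSup` (no definition introduced), in the exact
form of the crux `PolycrystalWulffBound` of the venture `Summits/Ventures/Crystal3D` (single grain).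

Proof (this series): for bump kernels `ρ_k` concentrating at `0` and `u_k = ρ_k * χ_G`, part IV
gives `n vol(K)^{1/n} ∫_0^∞ (vol{u_k > t}^{1/n})^{n-1} dt ≤ P_K(G)`; by Lebesgue differentiation
`u_k → χ_G` a.e., so `vol(G) ≤ liminf_k vol{u_k > t}` for `t < 1`, and Fatou's lemma on
`t ∈ (0, 1)` concludes. No coarea formula, no structure theory of sets of finite perimeter and no
regularity of `G` is used.

## References
* J. E. Taylor, *Crystalline variational problems*, Bull. AMS 84 (1978) 568–588. [`Taylor1978`]
* I. Fonseca, S. Müller, *A uniqueness proof for the Wulff theorem*, Proc. Roy. Soc. Edinburgh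
  119A (1991) 125–136. [`FonsecaMuller1991`]
* R. J. Gardner, *The Brunn–Minkowski inequality*, Bull. AMS 39 (2002), §5. [`Gardner2002`]
-/

noncomputable section

open Set Filter Function Metric
open _root_.MeasureTheory _root_.MeasureTheory.Measure ContinuousLinearMap
open scoped ENNReal NNReal Topology Convolution InnerProductSpace Pointwise

namespace Literature.Analysis.Convexity

open Literature.MathematicalPhysics.StatisticalMechanics (fieldDivergence)

variable {n : ℕ}

/-- If `u_k → χ_G` almost everywhere, then `vol G ≤ liminf_k vol{t < u_k}` for every `t < 1`
(Fatou for sets). [folklore] -/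
private theorem volume_le_liminf_volume_superlevel {G : Set (EuclideanSpace ℝ (Fin n))}
    {u : ℕ → EuclideanSpace ℝ (Fin n) → ℝ}
    (hae : ∀ᵐ x, Tendsto (fun k => u k x) atTop (𝓝 (G.indicator (fun _ => (1 : ℝ)) x)))
    {t : ℝ} (ht : t < 1) :
    volume G ≤ liminf (fun k => volume {x | t < u k x}) atTop := by
  set A : ℕ → Set (EuclideanSpace ℝ (Fin n)) := fun N => ⋂ k, ⋂ (_ : N ≤ k), {x | t < u k x}
    with hA
  have hmono : Monotone A := by
    intro N N' hNN' x hx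
    simp only [hA, mem_iInter, mem_setOf_eq] at hx ⊢
    exact fun k hk => hx k (hNN'.trans hk)
  -- `G ⊆ ⋃ A_N` up to a null set
  have hsub : volume G ≤ volume (⋃ N, A N) := by
    have hGsub : ∀ᵐ x, x ∈ G → x ∈ ⋃ N, A N := by
      filter_upwards [hae] with x hx hxG
      rw [Set.indicator_of_mem hxG] at hx
      have hev : ∀ᶠ k in atTop, t < u k x := hx.eventually (Ioi_mem_nhds ht)
      obtain ⟨N, hN⟩ := eventually_atTop.1 hev
      refine mem_iUnion.2 ⟨N, ?_⟩
      simp only [hA, mem_iInter, mem_setOf_eq]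
      exact fun k hk => hN k hk
    calc volume G ≤ volume ((⋃ N, A N) ∪ {x | ¬ (x ∈ G → x ∈ ⋃ N, A N)}) :=
          measure_mono fun x hx => by
            by_cases h : x ∈ ⋃ N, A N
            · exact Or.inl h
            · exact Or.inr fun h' => h (h' hx)
      _ ≤ volume (⋃ N, A N) + volume {x | ¬ (x ∈ G → x ∈ ⋃ N, A N)} := measure_union_le _ _
      _ = volume (⋃ N, A N) := by rw [ae_iff.1 hGsub, add_zero]
  rw [hmono.measure_iUnion] at hsub
  rw [liminf_eq_iSup_iInf_of_nat]
  refine hsub.trans (iSup_mono fun N => le_iInf₂ fun k hk => measure_mono ?_)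
  intro x hx
  simp only [hA, mem_iInter, mem_setOf_eq] at hx
  exact hx k hk

/-- **The anisotropic isoperimetric (Wulff) inequality**, distributional form, `n ≥ 2`: for
`K ⊆ ℝⁿ` compact convex with `0 ∈ K` and `G` measurable of finite volume,
`n · vol(K)^{1/n} · (vol(G)^{1/n})^{n-1} ≤ sup {∫_G div η : η ∈ C¹_c(ℝⁿ; ℝⁿ), η(x) ∈ K ∀x}`.
[cite: FonsecaMuller1991, Theorem 3.2 (Wulff's inequality)] -/
theorem anisotropic_isoperimetric_inequality (hn : 2 ≤ n) {K : Set (EuclideanSpace ℝ (Fin n))}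
    (hK : IsCompact K) (hKc : Convex ℝ K) (h0K : (0 : EuclideanSpace ℝ (Fin n)) ∈ K)
    {G : Set (EuclideanSpace ℝ (Fin n))} (hG : MeasurableSet G) (hGfin : volume G < ⊤) :
    (n : ℝ≥0∞) * volume K ^ (n⁻¹ : ℝ) * (volume G ^ (n⁻¹ : ℝ)) ^ (n - 1) ≤
      ⨆ (φ : EuclideanSpace ℝ (Fin n) → EuclideanSpace ℝ (Fin n))
        (_ : ContDiff ℝ 1 φ ∧ HasCompactSupport φ ∧ ∀ x, φ x ∈ K),
        ENNReal.ofReal (∫ x in G, fieldDivergence φ x) := by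
  set χ : EuclideanSpace ℝ (Fin n) → ℝ := G.indicator fun _ => (1 : ℝ) with hχ_def
  have hχi : Integrable χ volume :=
    (integrable_indicator_iff hG).2 (integrableOn_const hGfin.ne)
  set P := ⨆ (φ : EuclideanSpace ℝ (Fin n) → EuclideanSpace ℝ (Fin n))
        (_ : ContDiff ℝ 1 φ ∧ HasCompactSupport φ ∧ ∀ x, φ x ∈ K),
        ENNReal.ofReal (∫ x in G, fieldDivergence φ x) with hP
  set c : ℝ≥0∞ := (n : ℝ≥0∞) * volume K ^ (n⁻¹ : ℝ) with hc
  have hcfin : c ≠ ⊤ := ENNReal.mul_ne_top (ENNReal.natCast_ne_top n)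
    (ENNReal.rpow_ne_top_of_nonneg (by positivity) hK.measure_lt_top.ne)
  -- bump functions at `0` with radii `rIn = 1/(k+2)`, `rOut = 2/(k+2)`
  have hbump : ∀ k : ℕ, ∃ b : ContDiffBump (0 : EuclideanSpace ℝ (Fin n)),
      b.rOut = 2 * ((k : ℝ) + 2)⁻¹ ∧ b.rOut = 2 * b.rIn := fun k =>
    ⟨⟨((k : ℝ) + 2)⁻¹, 2 * ((k : ℝ) + 2)⁻¹, by positivity, by
      have : (0 : ℝ) < ((k : ℝ) + 2)⁻¹ := by positivity
      linarith⟩, rfl, rfl⟩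
  choose bumpSeq hbOut hbRatio using hbump
  -- the kernels and the mollified indicators
  set ρ : ℕ → EuclideanSpace ℝ (Fin n) → ℝ := fun k => (bumpSeq k).normed volume with hρ
  set u : ℕ → EuclideanSpace ℝ (Fin n) → ℝ := fun k => ρ k ⋆[lsmul ℝ ℝ, volume] χ with hu
  -- part IV for each kernel
  have hkey : ∀ k, c * ∫⁻ t in Ioi (0 : ℝ), (volume {x | t < u k x} ^ (n⁻¹ : ℝ)) ^ (n - 1) ≤ P :=
    fun k => lintegral_rpow_volume_superlevel_le hn hK hKc h0K (bumpSeq k).contDiff_normed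
      (bumpSeq k).hasCompactSupport_normed ((bumpSeq k).normed_neg)
      ((bumpSeq k).nonneg_normed) (bumpSeq k).integral_normed hG hGfin
  -- a.e. convergence `u_k → χ_G` (Lebesgue differentiation)
  have hae : ∀ᵐ x, Tendsto (fun k => u k x) atTop (𝓝 (χ x)) := by
    have hφ : Tendsto (fun k => (bumpSeq k).rOut) atTop (𝓝 0) := by
      simp only [hbOut]
      have h1 : Tendsto (fun k : ℕ => ((k : ℝ) + 2)⁻¹) atTop (𝓝 0) := by
        have := tendsto_one_div_add_atTop_nhds_zero_nat (𝕜 := ℝ)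
        have h2 : Tendsto (fun k : ℕ => 1 / ((↑(k + 1) : ℝ) + 1)) atTop (𝓝 0) :=
          this.comp (tendsto_add_atTop_nat 1)
        refine h2.congr fun k => ?_
        push_cast; ring
      have := h1.const_mul 2
      rw [mul_zero] at this
      exact this
    have h'φ : ∀ᶠ k in atTop, (bumpSeq k).rOut ≤ 2 * (bumpSeq k).rIn :=
      Eventually.of_forall fun k => (hbRatio k).le
    exact ContDiffBump.ae_convolution_tendsto_right_of_locallyIntegrable hφ h'φ
      hχi.locallyIntegrable
  -- measurability in `t`
  have hVm : ∀ k, Measurable fun t : ℝ => volume {x | t < u k x} := fun k =>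
    Antitone.measurable fun s t hst => measure_mono fun x (hx : t < u k x) => lt_of_le_of_lt hst hx
  -- the integrand as a monotone continuous function of the volume
  set g : ℝ≥0∞ → ℝ≥0∞ := fun v => c * (v ^ (n⁻¹ : ℝ)) ^ (n - 1) with hg
  have hgm : Monotone g := fun v w hvw => by
    simp only [hg]; gcongr
  have hgc : Continuous g :=
    (ENNReal.continuous_const_mul hcfin).comp
      ((ENNReal.continuous_pow (n - 1)).comp ENNReal.continuous_rpow_const)
  -- Fatou on `t ∈ (0, 1)`
  have hFatou : ∫⁻ t in Ioo (0 : ℝ) 1, liminf (fun k => g (volume {x | t < u k x})) atTop ≤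
      liminf (fun k => ∫⁻ t in Ioo (0 : ℝ) 1, g (volume {x | t < u k x})) atTop :=
    lintegral_liminf_le' fun k => (hgc.measurable.comp (hVm k)).aemeasurable
  calc c * (volume G ^ (n⁻¹ : ℝ)) ^ (n - 1)
      = ∫⁻ t in Ioo (0 : ℝ) 1, g (volume G) := by
        rw [setLIntegral_const, Real.volume_Ioo, sub_zero, ENNReal.ofReal_one, mul_one]
    _ ≤ ∫⁻ t in Ioo (0 : ℝ) 1, liminf (fun k => g (volume {x | t < u k x})) atTop := by
        refine setLIntegral_mono_ae ?_ ?_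
        · exact (Measurable.liminf fun k => hgc.measurable.comp (hVm k)).aemeasurable
        · refine Eventually.of_forall fun t ht => ?_
          rw [show (fun k => g (volume {x | t < u k x})) = g ∘ fun k => volume {x | t < u k x}
            from rfl, ← hgm.map_liminf_of_continuousAt _ hgc.continuousAt]
          exact hgm (volume_le_liminf_volume_superlevel hae ht.2)
    _ ≤ liminf (fun k => ∫⁻ t in Ioo (0 : ℝ) 1, g (volume {x | t < u k x})) atTop := hFatou
    _ ≤ P := by
        refine liminf_le_of_frequently_le (Eventually.of_forall fun k => ?_).frequently
        refine le_trans ?_ (hkey k)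
        rw [hg]
        simp only []
        rw [lintegral_const_mul' _ _ hcfin]
        exact mul_le_mul_right (lintegral_mono_set Ioo_subset_Ioi_self) _

/-- **The anisotropic isoperimetric (Wulff) inequality**, exponent form:
`n · vol(K)^{1/n} · vol(G)^{(n-1)/n} ≤ P_K(G)` for `K` compact convex with `0 ∈ K`, `G` measurable of
finite volume, `n ≥ 2`. [cite: FonsecaMuller1991, Theorem 3.2 (Wulff's inequality)] -/
theorem anisotropic_isoperimetric_inequality' (hn : 2 ≤ n) {K : Set (EuclideanSpace ℝ (Fin n))}
    (hK : IsCompact K) (hKc : Convex ℝ K) (h0K : (0 : EuclideanSpace ℝ (Fin n)) ∈ K)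
    {G : Set (EuclideanSpace ℝ (Fin n))} (hG : MeasurableSet G) (hGfin : volume G < ⊤) :
    (n : ℝ≥0∞) * volume K ^ (n⁻¹ : ℝ) * volume G ^ (((n : ℝ) - 1) / n) ≤
      ⨆ (φ : EuclideanSpace ℝ (Fin n) → EuclideanSpace ℝ (Fin n))
        (_ : ContDiff ℝ 1 φ ∧ HasCompactSupport φ ∧ ∀ x, φ x ∈ K),
        ENNReal.ofReal (∫ x in G, fieldDivergence φ x) := by
  have hn1 : 1 ≤ n := by omega
  have h := anisotropic_isoperimetric_inequality hn hK hKc h0K hG hGfin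
  have hexp : (volume G ^ (n⁻¹ : ℝ)) ^ (n - 1) = volume G ^ (((n : ℝ) - 1) / n) := by
    rw [← ENNReal.rpow_natCast, ← ENNReal.rpow_mul, Nat.cast_sub hn1, Nat.cast_one,
      inv_mul_eq_div]
  rwa [hexp] at h


/-! ### The isotropic case: the isoperimetric inequality for De Giorgi's perimeter -/

/-- **The isoperimetric inequality for sets of finite volume in `ℝⁿ`** (`n ≥ 2`), sharp constant:
`n · vol(B̄(0,1))^{1/n} · vol(G)^{(n-1)/n} ≤ Per(G)` for every measurable `G` of finite volume, where
`Per` is De Giorgi's distributional perimeter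
(`Literature.MathematicalPhysics.StatisticalMechanics.perimeter`: test fields `φ ∈ C¹_c` with
`‖φ‖ ≤ 1`, i.e. `φ(x) ∈ B̄(0,1)`) — the case `K = B̄(0,1)` of the Wulff inequality.
[cite: Federer1969, §4.5.9 (31)] -/
theorem isoperimetric_inequality_perimeter (hn : 2 ≤ n) {G : Set (EuclideanSpace ℝ (Fin n))}
    (hG : MeasurableSet G) (hGfin : volume G < ⊤) :
    (n : ℝ≥0∞) * volume (closedBall (0 : EuclideanSpace ℝ (Fin n)) 1) ^ (n⁻¹ : ℝ) *
        (volume G ^ (n⁻¹ : ℝ)) ^ (n - 1) ≤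
      Literature.MathematicalPhysics.StatisticalMechanics.perimeter G := by
  have h := anisotropic_isoperimetric_inequality hn (isCompact_closedBall (0 : EuclideanSpace ℝ
    (Fin n)) 1) (convex_closedBall 0 1) (mem_closedBall_self zero_le_one) hG hGfin
  refine h.trans (iSup₂_le fun φ hφ => ?_)
  refine Literature.MathematicalPhysics.StatisticalMechanics.le_perimeter ⟨hφ.1, hφ.2.1, fun x => ?_⟩
  simpa using hφ.2.2 x
end Literature.Analysis.Convexity

end
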